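import Literature.NumberTheory.EllipticCurves.OrdinaryLocalCondition
import Literature.NumberTheory.EllipticCurves.GlobalMinimalModel
import Literature.NumberTheory.EllipticCurves.BSDConductor
import Literature.NumberTheory.EllipticCurves.HeegnerPointsKolyvaginEulerSystem
import Literature.NumberTheory.EllipticCurves.BertoliniDarmon2005.AdmissiblePrimes
import Mathlib.Algebra.Module.ZMod
import HarnessLib

/-!
# Route `AdditiveKolyvaginRoad`, crux `KolyvaginPrimitiveAdditive` (item stmt-BirchSwinnertonDyer-20132):
# the CANONICAL LEVEL-RAISED SELMER SPACES at Bertolini–Darmon admissible levels, for a GENERAL prime `p`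
# (the `p`-generic companion of `Theorems/KolyvaginRoadThreeMethod2Defs.lean`; definitions)
# (cell `pub/bsd-wall`, lead prover `bsd-wall-akr-p1`; `--supports stmt-BirchSwinnertonDyer-20132`, helper; kind definition)

WHY THIS FILE. W. Zhang's induction on the Selmer rank (Camb. J. Math. 2 (2014) §9) — the idea of the birth line of
crux 20132 (Kolyvagin's conjecture mod `p` at an ADDITIVE prime `p ≥ 5`) — runs on the LEVEL-RAISED Selmer groups
`Sel_{𝔭_n}(A_n/K) ⊗ k ⊂ H¹(K, E[p])` at square-free products `n` of admissible primes. The tree's composition engine for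
that induction (`Theorems/KolyvaginRoadThreeZhangInduction*.lean`, zhang3-p1 ∕ koly3a ∕ koly3b) is pure linear algebra,
uniform in the coefficient field, and consumes those spaces as DATA; the `p = 3` cell pinned them to arithmetic in
`Theorems/KolyvaginRoadThreeMethod2Defs.lean` — hard-wired to `3` (ambient `H¹(K, E[3])`, UNIPOTENT-admissible primes,
`ZMod 3`). The honest form of the induction stub of crux 20132 above the bottom (skeleton v4's S2
`stub_inductionOddRankGeThreeAdditive`, RESIDUAL with a declared costume flag) needs the same objects at a general prime
`p`; this file provides them, so that the (A1) RANK-LOWERING input (W. Zhang Prop. 5.4 + Lemma 7.3 — E-side, PRINTED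
for `p ≥ 5`) and the level Kolyvagin systems can be stated over pinned canonical spaces at additive `p` exactly as at
`p = 3` (crux 19574 skeleton method2 v2u…v3). Bodies follow `Method2Defs` VERBATIM except at two points:

* ADMISSIBLE PRIMES are Bertolini–Darmon's (`BertoliniDarmon2005.IsAdmissiblePrime N_E K (a_•(E)) p 1 q`, Ann. of
  Math. 162 (2005) p. 18 = W. Zhang 2014 Notations (xiv): `q ∤ pN`, `q` inert in `K`, `p ∤ q² − 1`,
  `p ∣ q + 1 ∓ a_q`). Clause `p ∤ q² − 1` forces `Frob_q² ≠ 1` on `E[p]` (the eigenvalues `ε, εq` of `Frob_q` square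
  to `1, q² ≢ 1`), so NO «good level» relativisation (`Method2.GoodLevel`, the `p = 3` repair (R3)) is needed.
* THE LOCAL CONDITION AT `q ∈ n` is the TORIC one for a general `p`: classes whose localisation at the inert place
  `v ∣ q` is represented by a cocycle valued in the AUGMENTATION LINE `I_Γ · E[p] = ⟨g x − x⟩` of the local torsion
  points (`toricLocalKer`, §0). At a BD-admissible `q` (`E[p]|_{Γ_{K_v}} ≅ ℤ/p ⊕ μ_p`, `Frob_v = diag(1, q²)`) this is the
  `μ_p`-line = the `χ_p`-eigenline = the filtration `F⁺` of the Tate curve of every form raised at `q` — Bertolini–Darmon's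
  `H¹_ord(K_q, ·)` (§2.2–2.3), W. Zhang's `H¹_ord` (§4.1); the tree's `ordinaryLocalKer` (values in the Γ-FIXED line) is
  that condition only for UNIPOTENT residual Frobenius (`p = 3`), as its own docstring warns, and there the two agree
  (`I_Γ · E[3] = im N = ker N`). So `toricLocalKer` is the `p`-uniform object.

HONEST FRAMING. Definitions and three monotonicity lemmas (the (A4) RELAXATION of Zhang (9.3), definitional); nothing
about Heegner points, level raising, admissible-prime supply or the crux is asserted; no named fact; no `sorry`; no
instance is declared (the `ZMod p`-structure of `H¹(K, E[p])` enters `SelQ` ∕ `SelRelQ` as an instance BINDER, discharged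
by `AddCommGroup.zmodModule` + `zsmul_discreteH1_torsion` at the call site, as in the `p = 3` skeleton); no notation.
TODO(Literature home): `augmentationPoints` ∕ `toricLocalKer` belong next to `ordinaryLocalKer` in
`Literature/NumberTheory/EllipticCurves/OrdinaryLocalCondition.lean` (its WARNING paragraph asks for exactly this
object); kept here, Summits-side, until a consumer outside this route exists.

## The objects (W. Zhang, Camb. J. Math. 2 (2014), §4.1, §5, Def. 8.3, (9.3); Bertolini–Darmon 2005 §2.2–2.3)

* `augmentationPoints G M` — the augmentation subgroup `I_G · M = ⟨g • x − x⟩` of a `G`-module.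
* `toricLocalKer W E n` — the TORIC local condition at a `K`-field `E`: `x_v` represented by an `I_Γ·E[n]`-valued cocycle.
* `Vp W K p` = `H¹(K, E[p])` (tree `galH1Torsion (W.baseChange K) (p^1)`), the ambient space of the crux's classes.
* `AdmQ W K p` — the subtype of BD `1`-admissible primes `q` for `(E, K, p)` (Literature predicate, inline).
* `levelSelmerSubgroupP W K p c n S μ` — the canonical level-raised eigen-Selmer space `Sel_n^μ ⊂ H¹(K, E[p])` relaxed
  at `S`: `μ`-eigenclasses of complex conjugation `c` with E's Kummer condition at ∞ and at the finite places above no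
  prime of `n ∪ S`, and the TORIC condition at the places above `q ∈ n ∖ S`.
* `SelQP` ∕ `SelRelQP` — the same as `ZMod p`-subspaces, indexed by finite sets of admissible primes.
* `baseLocusQP κ n` — Zhang's base locus (Def. 8.3 verbatim: localisation ZERO of every class `κ m n`).

References: [cite: WZhang2014, §4.1, §5 (Sel_{𝔭_n}), Prop. 5.4, Definition 8.3, (9.3)] [cite: BertoliniDarmon2005,
p. 18 and §2.2–§2.3].
-/

-- single-conjunct summit: `Summit.BirchSwinnertonDyer.BirchSwinnertonDyer.…` repeats the name by design
set_option linter.dupNamespace false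

noncomputable section

open scoped Classical

universe u

/-! ## §0 The augmentation line and the toric local condition (p-uniform `H¹_ord`) -/

namespace Summit.BirchSwinnertonDyer.BirchSwinnertonDyer.Theorems.AdditiveKoly

open WeierstrassCurve NumberField IsDedekindDomain
  Literature.NumberTheory.EllipticCurves Literature.NumberTheory.GaloisRepresentations Module

/-- **The augmentation subgroup `I_G · M = ⟨g • x − x : g ∈ G, x ∈ M⟩`** of a `G`-module `M` (the kernel of
`M → M_G` onto the coinvariants). For `M = E[p]|_{Γ_{K_v}} ≅ ℤ/p ⊕ μ_p` at a Bertolini–Darmon admissible prime it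
is the `μ_p`-line; for a unipotent residual Frobenius (`p = 3`) it is `im N = ker N` = the fixed line. [folklore] -/
def augmentationPoints (G : Type*) (M : Type*) [Monoid G] [AddCommGroup M] [DistribMulAction G M] :
    AddSubgroup M :=
  AddSubgroup.closure {m : M | ∃ (g : G) (x : M), m = g • x - x}

variable {K : Type u} [Field K] (W : WeierstrassCurve K) (E : Type u) [Field E] [Algebra K E]

/-- **The TORIC local condition at `E`** (a completion `K_v`): the classes `x ∈ H¹(K, E[n])` whose localisation
`x_v` is represented by a cocycle with values in the augmentation line `I_{Γ_E} · E(K̄_E)[n]` (tree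
`WeierstrassCurve.valuedLocalKer`). At an admissible prime this is Bertolini–Darmon's `H¹_ord(K_q, E[p]) =
im H¹(K_q, F⁺)`, `F⁺` the toric filtration of every form raised at `q`; `p`-uniform replacement of the tree's
`ordinaryLocalKer`. [cite: BertoliniDarmon2005, §2.2–§2.3 (ordinary part)] [cite: WZhang2014, §4.1 (H¹_ord)] -/
def toricLocalKer (n : ℤ) : AddSubgroup (galH1Torsion W n) :=
  W.valuedLocalKer E n
    (augmentationPoints (Field.absoluteGaloisGroup E) (AddSubgroup.torsionBy (localPoints W E) n))

end Summit.BirchSwinnertonDyer.BirchSwinnertonDyer.Theorems.AdditiveKoly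

/-! ## §1 The canonical level-raised Selmer spaces at admissible levels, general `p` -/

namespace Summit.BirchSwinnertonDyer.BirchSwinnertonDyer.Theorems.AdditiveKoly

open WeierstrassCurve NumberField IsDedekindDomain
  Literature.NumberTheory.EllipticCurves Literature.NumberTheory.GaloisRepresentations Module

variable (W : WeierstrassCurve ℚ) (K : Type) [Field K] [NumberField K] (p : ℕ)

/-- **`H¹(K, E[p])`** — the ambient space of the crux's classes `d.kolyvaginClass hp 1` (tree `galH1Torsion` of the
base change `E/K` at the torsion level `p = p¹`, written `p ^ 1` to match `KolyvaginHeegnerData.kolyvaginClass`).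
[cite: WZhang2014, §3.7 (3.21)] -/
abbrev Vp : Type := galH1Torsion (W.baseChange K) ((p ^ 1 : ℕ) : ℤ)

/-- **The type of Bertolini–Darmon `1`-admissible primes for `(E, K, p)`**: the subtype of `ℕ` cut out by the
Literature predicate `BertoliniDarmon2005.IsAdmissiblePrime` at the level `N_E = W.conductorNorm ℤ`, the Hecke
eigenvalues `a_ℓ(E) = W.frobeniusTrace ℓ` (globally minimal `W`) and exponent `1` — `q` prime, `q ∤ p N_E`, `(q)` prime
in `𝓞 K`, `p ∤ q² − 1`, `p ∣ q + 1 − a_q ∨ p ∣ q + 1 + a_q` (= W. Zhang 2014 Notations (xiv); the shape used inline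
by stub S of the crux's skeleton). Levels are `Finset`s of this type. [cite: BertoliniDarmon2005, p. 18 (Admissible
primes)] [cite: WZhang2014, Notations (xiv)] -/
abbrev AdmQ [W.IsGloballyMinimal] : Type :=
  {q : ℕ // BertoliniDarmon2005.IsAdmissiblePrime (W.conductorNorm ℤ) K (fun ℓ ↦ W.frobeniusTrace ℓ) p 1 q}

/-- The sign attached to an eigenvalue index (`true ↦ +1`, `false ↦ −1`). [folklore] -/
def sgnP (μ : Bool) : ℤ := if μ then 1 else -1

variable (c : K ≃ₐ[ℚ] K)

/-- **The canonical LEVEL-RAISED eigen-Selmer space `Sel_n^μ ⊂ H¹(K, E[p])`, relaxed at `S`, general `p`** (W. Zhang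
2014, `Sel_{𝔭_n}(A_n/K)^± ⊗ k`, defined WITHOUT `A_n`): the `μ`-eigenclasses of complex conjugation `c` satisfying
E's Kummer condition at every infinite place and at every finite place above no prime of `n ∪ S`, and the TORIC
condition (`toricLocalKer`) at the places above the primes of `n` not in `S`. (Body = `Method2.levelSelmerSubgroup`
with `3 ↦ p` and `ordinaryLocalKer ↦ toricLocalKer`.) [cite: WZhang2014, §4.1 and §5 (Sel_{𝔭_n})]
[cite: BertoliniDarmon2005, §2.3] -/
def levelSelmerSubgroupP (n : Finset ℕ) (S : Set ℕ) (μ : Bool) : AddSubgroup (Vp W K p) :=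
  (conjAct W c ((p ^ 1 : ℕ) : ℤ) - sgnP μ • AddMonoidHom.id (Vp W K p)).ker ⊓
  ((⨅ (w : InfinitePlace K), selmerLocalKer (W.baseChange K) w.Completion ((p ^ 1 : ℕ) : ℤ)) ⊓
  ((⨅ (v : HeightOneSpectrum (𝓞 K)) (_ : ∀ q ∈ (n : Set ℕ) ∪ S, (q : 𝓞 K) ∉ v.asIdeal),
      selmerLocalKer (W.baseChange K) (v.adicCompletion K) ((p ^ 1 : ℕ) : ℤ)) ⊓
  (⨅ (q : ℕ) (_ : q ∈ n ∧ q ∉ S) (v : HeightOneSpectrum (𝓞 K)) (_ : (q : 𝓞 K) ∈ v.asIdeal),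
      toricLocalKer (W.baseChange K) (v.adicCompletion K) ((p ^ 1 : ℕ) : ℤ))))

variable [W.IsGloballyMinimal]

/-- `Sel_n^μ` as a `ZMod p`-subspace of `H¹(K, E[p])` (for its unique `ZMod p`-structure, supplied as an instance
binder), `n` a finite set of admissible primes. [cite: WZhang2014, §5 (Sel_{𝔭_n})] -/
def SelQP [Module (ZMod p) (Vp W K p)] (n : Finset (AdmQ W K p)) (μ : Bool) :
    Submodule (ZMod p) (Vp W K p) :=
  AddSubgroup.toZModSubmodule p (levelSelmerSubgroupP W K p c (n.image Subtype.val) ∅ μ)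

/-- `Sel_n^μ` relaxed at the admissible primes in `S`, as a `ZMod p`-subspace. [cite: WZhang2014, Lemma 8.4 (3)
(relaxed Selmer group)] -/
def SelRelQP [Module (ZMod p) (Vp W K p)] (n : Finset (AdmQ W K p))
    (S : Set (AdmQ W K p)) (μ : Bool) : Submodule (ZMod p) (Vp W K p) :=
  AddSubgroup.toZModSubmodule p (levelSelmerSubgroupP W K p c (n.image Subtype.val) (Subtype.val '' S) μ)

/-- **The base locus of a system of classes at level `n`** (W. Zhang 2014, Definition 8.3, VERBATIM): the admissible
primes `q` at whose place EVERY class `κ m n` has localisation ZERO in `H¹(K_q, E[p])` (tree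
`WeierstrassCurve.torsionLocalKer`). [cite: WZhang2014, Definition 8.3] -/
def baseLocusQP {M : Type} (κ : M → Finset (AdmQ W K p) → Vp W K p)
    (n : Finset (AdmQ W K p)) : Set (AdmQ W K p) :=
  {q | ∀ m, ∀ v : HeightOneSpectrum (𝓞 K), ((q : ℕ) : 𝓞 K) ∈ v.asIdeal →
    κ m n ∈ (W.baseChange K).torsionLocalKer (v.adicCompletion K) ((p ^ 1 : ℕ) : ℤ)}

/-- **(A4) RELAXATION is definitional** (W. Zhang 2014, (9.3)): dropping the conditions above `S ∋ q` can only
enlarge the canonical space (Kummer condition on a SMALLER set of places; toric condition on `n \\ S ⊆ (n ∪ {q}) \\ S`).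
Proof = `Method2.relaxation_le` verbatim. [cite: WZhang2014, §9 (9.3)] -/
theorem relaxationP_le [Module (ZMod p) (Vp W K p)]
    (n : Finset (AdmQ W K p)) (q : AdmQ W K p)
    (S : Set (AdmQ W K p)) (s : Bool) (hqn : q ∉ n) (hqS : q ∈ S) :
    SelQP W K p c n s ≤ SelRelQP W K p c (insert q n) S s := by
  change AddSubgroup.toZModSubmodule p _ ≤ AddSubgroup.toZModSubmodule p _
  refine (OrderIso.le_iff_le _).mpr ?_
  unfold levelSelmerSubgroupP
  refine inf_le_inf le_rfl (inf_le_inf le_rfl (inf_le_inf ?_ ?_))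
  · -- the finite (Kummer) conditions: fewer places upstairs
    refine le_iInf fun v ↦ le_iInf fun hv ↦ iInf_le_of_le v (iInf_le _ fun q' hq' ↦ hv q' ?_)
    rcases hq' with hq' | hq'
    · left
      rw [Finset.mem_coe, Finset.mem_image] at hq' ⊢
      obtain ⟨a, ha, rfl⟩ := hq'
      exact ⟨a, Finset.mem_insert_of_mem ha, rfl⟩
    · exact absurd hq' (Set.notMem_empty _)
  · -- the toric conditions: every q' ≠ q of (insert q n) \ S is in n
    refine le_iInf fun q' ↦ le_iInf fun hq' ↦ le_iInf fun v ↦ le_iInf fun hv ↦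
      iInf_le_of_le q' (iInf_le_of_le ?_ (iInf_le_of_le v (iInf_le _ hv)))
    obtain ⟨hmem, hnot⟩ := hq'
    refine ⟨?_, Set.notMem_empty _⟩
    rw [Finset.mem_image] at hmem ⊢
    obtain ⟨a, ha, rfl⟩ := hmem
    rcases Finset.mem_insert.mp ha with rfl | ha
    · exact absurd ⟨a, hqS, rfl⟩ hnot
    · exact ⟨a, ha, rfl⟩

/-- **Monotonicity of relaxation in `S`**: `S ⊆ S'` ⟹ `SelRel n S ≤ SelRel n S'`. Proof = `Method2.selRelQ_mono`
verbatim. [folklore] -/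
theorem selRelQP_mono [Module (ZMod p) (Vp W K p)]
    (n : Finset (AdmQ W K p)) {S S' : Set (AdmQ W K p)} (hSS' : S ⊆ S')
    (s : Bool) : SelRelQP W K p c n S s ≤ SelRelQP W K p c n S' s := by
  change AddSubgroup.toZModSubmodule p _ ≤ AddSubgroup.toZModSubmodule p _
  refine (OrderIso.le_iff_le _).mpr ?_
  unfold levelSelmerSubgroupP
  refine inf_le_inf le_rfl (inf_le_inf le_rfl (inf_le_inf ?_ ?_))
  · refine le_iInf fun v ↦ le_iInf fun hv ↦ iInf_le_of_le v (iInf_le _ fun q' hq' ↦ hv q' ?_)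
    rcases hq' with hq' | hq'
    · exact Or.inl hq'
    · exact Or.inr (Set.image_mono hSS' hq')
  · refine le_iInf fun q' ↦ le_iInf fun hq' ↦ le_iInf fun v ↦ le_iInf fun hv ↦
      iInf_le_of_le q' (iInf_le_of_le ?_ (iInf_le_of_le v (iInf_le _ hv)))
    exact ⟨hq'.1, fun h ↦ hq'.2 (Set.image_mono hSS' h)⟩

/-- `Sel_n^μ` is `Sel_n^μ` relaxed at nothing: `SelQP n = SelRelQP n ∅`. [folklore] -/
theorem selQP_eq_selRelQP_empty [Module (ZMod p) (Vp W K p)]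
    (n : Finset (AdmQ W K p)) (s : Bool) : SelQP W K p c n s = SelRelQP W K p c n ∅ s := by
  unfold SelQP SelRelQP
  rw [Set.image_empty]

end Summit.BirchSwinnertonDyer.BirchSwinnertonDyer.Theorems.AdditiveKoly

end
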